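import Summits.QuantumFields.YangMills.Theorems.BalabanUVNodesN12AtRecord13Prop1KnitThm1OfRecord
import Summits.QuantumFields.YangMills.Theorems.BalabanUVNodesN12Prop1DirectOfClassOnlyRowL1WindowUniform

/-!
# BalabanUVNodes ∕ N12 — «12Q-DIRECT v10»: N12's Proposition-1 row at the record ON THE DIRECT ROAD, keyed on `(x)_direct` = (E1)⁶ `N12Prop1DirectOfClassOnlyRowL1WindowUniform` — NO SMALL-BELOW LETTER, (μ) ROW
# IN PER-ROW ℓ¹ CURRENCY ((P2c)‴ chart half on dag-n12-c g22's ρ6b ∘ (D1)⁵ (P4)′ PROXIES letter as surjectivity witness + PER-ROW ℓ¹ PREIMAGE letter, (P5) by ρ7 with the closed-form local count ∘ dag-n12-w6 g7's k-UNIFORM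
# WINDOW-LOCAL (σ)_W producer ∘ dag-n12-c g21's class producers for the plaquette letters) — NO TORUS BOND COUNT `√#PBond` IN THE DISPLAYED THRESHOLD (census U2b):
# NO (σ)-letter, NO plaquette letter, NO (P4)′ socket, NO topological hypothesis, NO `∃ δ₀` — EXPLICIT threshold per run, and under it ONE numeric row: the k-free floor `C(d,L)·εreg + m′·ρn ≤ δ`

Cell `pub-ymgap` (HUMAN RULINGS D-0062 ∕ D-0149), seat `pub-ymgap-dag-n12-d` g21 (R134 N12 [B15] s2; pen (P3) of plan g87 YMPLAN-G87-N12-ROAD on the LOCATED-FLOOR ∕ LOCATED-HSB repair chain of 2026-08-28, re-keyed to the lane's v10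
recipe INBOX l.44281 as amended by INTENT-3 l.44505 (ρ6b) ∕ INTENT-2 l.44402 (ρ7)); count-neutral helper of K1⁹ `stmt-QuantumFields-27364` (`--kind proof --supports … --as helper`).  THEOREMS ONLY (0 `def`, 0 `instance`, 0 `sorry`); composition BY NAME.

WHAT.  «12Q-DIRECT» (p658022) displayed the (WD) window∕direct letter package whole; «v2» keyed on (P2c) (p662019), «v3» on `(iv)_direct` (p664306), «v4» (p672225) on `(iv)_direct′`
(p671908).  All of those carried (P2c)'s frame `∃ δ₀ > 0, ∀ δ ≤ δ₀, ∀ (letters at δ), …` — harmless while the thresholded rows are LETTERS, but VACUOUS BY SHAPE the moment a producer turns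
a letter into a numeric floor (dag-n12-c g21's LOCATED-FLOOR, kernel certificate `B15Prop1NumericsThresholds.exists_threshold_frame_of_pos_floor`).  THIS edition keys on the repaired chain IN PER-ROW ℓ¹ CURRENCY
(v9 p682012 ∕ p682015 read the right inverse through the ℓ² letter `√(Σ_b‖(H v)_b‖²) ≤ B‖v‖` and the curvature through the sup letter, so its `Θ` carried `Cμ := 2(d−1)√#PBond·B·M₂` — the
TORUS bond count; dag-n12-c g22's ρ6b reads the (μ) row through the linearity of the multiplier, so only ONE-ROW data need preimages, and ρ7 bounds the constraint-ℓ¹ curvature with a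
LOCAL count): this seat's (P2c)‴ `N12Prop1DirectOfChartHalfOfClassRowL1Explicit.…` (= (P2c)″ p680717 with the chart-half letter of ρ6b
`N12DirectChartPackageOfClassRowL1Family.exists_hWD_chartHalf_of_class_uniform_rowl1_family`: constants `C ρ Kτ ρτ ρ5` as binders, rows `hk1 hM4 hεreg hερ`; right inverse `H` = surjectivity
witness, PER-ROW ℓ¹ PREIMAGE letter at `B₁`, ℓ¹-curvature letter at `M₂`, (μ) constant `2(d−1)·εP·B₁·M₂`; threshold CLOSED-FORM; `hsm` by §7 `hsm_direct_of_le_explicitThreshold`) ∘ this seat's (D1)⁵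
`N12Prop1DirectOfClassOnlyRowL1.…` ((P5) row fed by ρ7 `N12ChartCurvatureL1OfClass.sum_norm_fderiv_fderiv_msChart_apply_le_of_class` at displayed letters `hsbU hcurv` ∕ binders `ρ6 M₂` ∕ floor `hερ6`
with the local count in CLOSED FORM `Σ_{j≤k}(2d)^j` (`hovl_geometric`); (P4)′ socket replaced by dag-n12-w6 g7's PROXIES edition p678596 — letter `hHrow` at displayed constants `εH B₁` (its premises
verbatim, its guarded proxies produced from the class by ρ5b `towerProxies_Bj_of_mem_class` p677953 and `siteProxies_Bj_of_mem_class` p679665; conclusion `∃ H, hHinv ∧ per-row ℓ¹ preimage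
letter at B₁`, inhabited today by p678596 ∘ `hHB1_of_hHB` ∘ `hrow_of_hHB1`); tower-box plaquette letter `hPbox`, `hk1`) ∘ this seat's (E1)⁶ `N12Prop1DirectOfClassOnlyRowL1WindowUniform.…` ((σ)_W discharged by dag-n12-w6 g7's k-UNIFORM window-LOCAL producer
`N12WindowGaugeLetterUniformSocket.hσW_on_uniform_of_class` p675589 — general `Z`, no letter off the window, graded [15] Thm 1 letter read off the class at level `k−1`; the plaquette letter
`hPχ` and the tower-box plaquette letter `hPbox` discharged by dag-n12-c g21's `B15Prop1PlaquetteLettersOfClass.hPχ_on_of_class` ∕ `hPbox_on_of_class` p675521 — what remains under the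
threshold is ONE numeric row, the producer's k-FREE tolerance FLOOR; sibling «v9» p682012 ∕ p682015 keys on (E1)⁵ p681826, ℓ² currency with `√#PBond` in `Θ`).  Hence the statement, per run `P`: all
tolerance-free rows as binders ((J0′)@eR + `h𝓐₀`, region boxes + `ρn hρn`, `Kb`, `γ₈ cJ bx`, dag-n12-w4's geometry letter `hΩw`, the window `W` + `hWbox`, the k-uniform producer's
numerics `c hkc hc`, class rows `hεreg hα3 hα2 haN`, window rows `X D₀ hXΩ hfit hBox hWX hfeedsX` (window within walk-distance `D₀` of `Ω_k(Z)`, collar fit inside `L^{k−1}·M₁`), the chart half `C ρ Kτ ρτ ρ5 hρ hKτ hρτ` + the `hsb`-free letter `hhalf` + its rows `hM4 hερ`, the guard∕curvature letters `ρ6`+`hsbU hcurv` + floor `hερ6`, the (P4)′ constants `εH B₁` + letter `hHrow`,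
(P5) `M₂ hM₂0` (its letter `hM₂` is fed from the class), `hγle` at `γ₀ = 1∕2`, geometry, `cE cA` rows, `h15`), then
`∀ δ, (∀ P i, 0 < δ P i) → (∀ P i, δ P i ≤ min (Θ P i) (εH P i)) → ∀ (hfloor), ∃ areg > 0, ∀ P, kSel < K → B15Leaf (…)` with `Θ P i` SPELLED OUT
(`min (min ρ ρτ ∕ 2) (min 1 (rhs ∕ (max S 0 + 1)))` at `Kc := 12𝓐₀∕R·√#{b ∕∕ b.src ∈ Ω₁(Z)}`, `Cμ := 2(d−1)·B₁·((Σ_{j≤k}(2d)^j)·M₂)` — NO torus bond count, `Cτ := 16(d+1)(Kτ+1) + 8d·#box·(C·Kc)²`, `rhs := (1∕2)∕(2(3Kb²+2Kb⁴))`)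
and ONE tolerance row at `δ P i`: the producer's k-FREE FLOOR `hfloor` (`(((4d+m′+3)²L²∕4) + m′·24(((d+2)L)²∕4))·εreg + m′·ρn P i ≤ δ P i` — a checkable smallness condition on the
record's class threshold `εreg` and the datum tolerance, uniform in the height; it implies `εreg ≤ δ P i`, the class producers' tolerance condition) — NO letter about the minimiser under the threshold.  Generated by the seat's
explicit-frame re-keyer (`lean/g21/mk_knit_expl.py spec_dir10.json`).

HONEST FRAMING ∕ LOCATED.  Bookkeeping by name over landed modules; NO (σ)-letter and NO scope line remain (the k-uniform window-LOCAL producer has no hypothesis off the window; its floor constant `C(d,L)` is explicit and k-free — still NOT print's per-level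
`O(1)` bookkeeping of [15] (16)–(18)); NO small-below letter is displayed (LOCATED-HSB repaired end to end: chart side ρ5c, (P4)′ proxies p678596 + p677953∕p679665, (P5) p679666); the thresholds are per-instance and carry large-field-REGION counts (`√#bonds(Ω₁(Z))` in the (K) row, `#box`) and the per-height local count `Σ_{j≤k}(2d)^j`, but NO torus bond count in the (μ)-term (the torus plaquette count remains in `cA`∕`cJ`, census U3); `B₁` per `(M₁, Z)` (today's inhabitant `√#bonds(Ω₁(Z))·B`, LOCATED-B); the chart-half and
right-inverse letters, the window rows, the numerics, the small-below letter `hPχ` ∕ `hPbox`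
((P4)′ itself is DISCHARGED — the producer's `ε`, `B₁` are per-height ∕ per-instance EXISTENCE constants, print's volume-uniform (46)∕(83) NOT claimed), (P5), (J0′), [15] Thm 1, the geometry, K0b's residuals and N12's per-run rows below the torus stay LETTERS; per-instance constants; NO topological hypothesis on `Ω₁(Z)`;
nothing of Bałaban's asserted; N12 NOT discharged; K0⁷ ∕ K1⁹ NOT closed; counts unmoved; one finite 𝕋⁴ programme at fixed `ε = L^{-K}` — R4 closes only the conditional rung
`BalabanLadder.UV`; no summit statement is proved here and NOT the Yang–Mills mass gap (Clay); nothing continuum ∕ ℝ⁴ ∕ OS.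

References: [Balaban1989LargeFieldI] CMP 122 (1989) 175–202; [Balaban1989LargeFieldII] CMP 122 (1989) 355–392; [Balaban1988Convergent] CMP 119 (1988) 243–285; [Balaban1985Averaging] CMP 98 (1985) 17–51;
[Balaban1985Variational] CMP 102 (1985) 277–309 (locators in the theorem docstring).
-/

noncomputable section
open MeasureTheory Set Finset Metric Filter
open scoped Matrix.Norms.L2Operator BigOperators Matrix RealInnerProductSpace Real InnerProductSpace Topology

namespace Summit.QuantumFields.YangMills.BalabanUVNodes.N12AtRecord13Prop1KnitThm1WindowDirectOfClassOnlyRowL1OfRecord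

open Literature.MathematicalPhysics.QuantumFieldTheory.Balaban1983to89
open Literature.MathematicalPhysics.QuantumFieldTheory.Balaban1983to89.T4Continuum (T4Family LStep Letter walk walkEnd netDisp holAt)
open Literature.MathematicalPhysics.QuantumFieldTheory.Balaban1983to89.DagBinding
open Literature.MathematicalPhysics.QuantumFieldTheory.Balaban1983to89.Node00
open FlowStep (prefixOf BetaLowerH BetaUpperH)
open B15Claim189Assembly (Setting189 new189 chiPP dom half)
open B15 (Prop1Printed Ineq180)
open B15.BasicStep (Claim189)
open B15.PrelimIntegrations (Ineq191 Ineq195)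
open B15Chi124DetSets (E124)
open B14DomainGeom (Pt)
open B8Eq17ClassAkV1 (plaqsOf)
open B14.Eq216Concrete (inputs feeds)
open GaugeGroup (dist1)
open GaugeField (plaqHol gaugeAct)
open B15Claim189PrintedConditions (omegaOfChain)
open B15Claim189PinsOfHistory (N0OfRecord₁₃)
open B15Claim189LambdaPin (enlD)
open B15RPrime1100OfRep (rPrimeDataOfSel)
open Summit.QuantumFields.YangMills.BalabanUVNodes.N12AtRecord13OfResiduals (b15Leaf_WOfRecord₁₃_liveRepin₁₃_of_massLive_of_hasResiduals)
open Summit.QuantumFields.YangMills.BalabanUVNodes.N12AtRecord13Prop1KnitThm1OfRecord (thm1TorusClass_of_variationalThm1RegSepCoP7M)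
open T4CubeChartGnomonic (SU2)
open B15Prop1ChartSU2 (su2Chart)
open B15Prop1SliceCoordinates (GaugeSlice ιA)
open T4AxialGaugeSmallField (castSite boxPlaqs boxBonds)
open B6BondElimination (unitVec)
open B6TreeGaugePoincare (curl)
open B16Eq18Proof (box)
open B15Extension193 (extend)
open B15ShellGauge193 (shellGauge)
open B15Sect1Instances (fun177std)
open B14.Eq213DetSet (Bj maxDomT)
open B14.Eq213MaximalDomains (side)
open B14.Eq22Determines (blockIter IsBlockUnion)
open Literature.MathematicalPhysics.QuantumFieldTheory.BalabanImbrieJaffe1984to88.BIJ85Eq453GaugeField (qsstarGIter0)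
open B16Sect1Backgrounds (expMul toMS)
open B15DeterminingSets (pts DetBackground genSet IsMinimizer MSField avgFamily bondsOf DetSet embIter AgreeOn)
open B5Eq118OneStroke (iterBlockOf)
open Literature.MathematicalPhysics.QuantumFieldTheory.Balaban1983to89.Node00 (coeField constrEnum)
open B15Eq112TorusCover (lift)
open ExpMeanLog (deltaSU)
open B15Prop1Carrier (lfVarOn InstOn InstOn.std plaqsInside)
open Summit.QuantumFields.YangMills.BalabanUVNodes.N12Prop1DirectOfClassOnlyRowL1WindowUniform (exists_domain_prop1Printed_lfVarOn_std_su2_box_intrinsic_analytic_atZSeqCoPRecord_ofThm1TorusClass_ofMinimiserFamily_ofClassOnlyRowL1_ofWindowGaugeUniform_explicit)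
open T4AdjointCovarianceUnitary (lieSU)
open B15Prop1GradientFromNearValueAtCoPRecord (far_letter_of_box)
open B15Prop1AnalyticExtClause (cplxVec anExt)
open B15Prop1ChartCalculusSU2 (E3)

variable {F : T4Family}

/-! ## §1 `N = 2`, generic `Θ` carrying node00-def-K0b's residuals: N12's Prop-1 row keyed on `(x)_direct` (E1)⁶ (explicit threshold with NO torus bond count; NO small-below letter; (P4)′ proxies letter in per-row ℓ¹ currency; k-UNIFORM window gauge, plaquette letters and curvature from the class), no `∃ δ₀`, letter-free under the threshold -/

section Generic
variable (Θ : Stage13Params F 2) (lam : ResidW F 2)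

/-- **★★★★ N12's ROW BELOW THE TORUS AT THE LIVE RE-PIN, `N = 2`, AT PRINT's (1.74) OBJECT, PROP. 1 ON THE DIRECT ROAD FROM THE ASSEMBLED ENDPOINT (P2c),
THRESHOLD FRAME** — per run `P` for every tolerance family `δ` below the endpoint's EXPLICIT threshold `min (Θ P i) (εH P i)` and ONE per-run tolerance row `hfloor` (the
k-uniform window-LOCAL producer's floor), the endpoint (E1)⁶ `N12Prop1DirectOfClassOnlyRowL1WindowUniform.…` (tolerance-free letters fed per run ∕ instance) yields `areg P`; then 12E's
`b15Leaf_WOfRecord₁₃_liveRepin₁₃_of_massLive_of_hasResiduals`.  Displayed: see the module docstring.  Count-neutral; NOT a discharge of N12. [cite: Balaban1989LargeFieldI, (0.2)–(0.6) p.176, (1.74) p.192, p.193 ll.14–20, Prop. 1 (1.77)–(1.78) p.194 («for ε > 0 sufficiently small»), (1.79)–(1.80) p.195, (1.89) p.198, (1.99)–(1.102) pp.200–201; Balaban1989LargeFieldII, p.357, (1.7)–(1.13) pp.358–359, (1.17)–(1.19) pp.360–361; Balaban1988Convergent, (2.1) p.254, (2.12)–(2.14) pp.256–257, (2.18) p.257,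 (3.16) p.268, (3.22)–(3.25) pp.269–270; Balaban1985Variational, (3)–(4) p.278, Thm 1 (8) p.279, (16)–(18) p.280, (44)–(47) p.285, (83) p.290, Prop. 9 (190) p.309 (bookkeeping); Balaban1985Averaging, Prop. 2 (52)–(53) p.26] -/
theorem exists_areg_pinLF_b15Leaf_WOfRecord₁₃_liveRepin₁₃_of_massLive_of_hasResiduals_of_variationalThm1RegSepCoP7M_atZSeqCoPRecord_windowDirectOfClassOnlyRowL1 (hres : Θ.HasResidualsOfRecord F 2)
    -- N12's displays at the letters `kSel ∕ D189 ∕ D1100` of `λ`, run by run, BELOW THE TORUS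
    (hpin : ∀ P : B12.RunParams, lam.kSel P < P.K → lam.D1100 P
      = rPrimeDataOfSel (reprTOfRecord₁₃ F 2 (Θ.liveRepin₁₃ F 2) P (lam.kSel P))
          ((Θ.liveRepin₁₃ F 2).ppSel P (gOfRecord₁₃ F 2 (Θ.liveRepin₁₃ F 2) P) (lam.kSel P + 1))
          (fibOfSeq F (Θ.liveRepin₁₃ F 2).ν (Θ.liveRepin₁₃ F 2).τ9 P (gOfRecord₁₃ F 2 (Θ.liveRepin₁₃ F 2) P) (lam.kSel P + 1)))
    (hmassLive : ∀ P : B12.RunParams, lam.kSel P < P.K → ∀ s, LiveSeq F 2 Θ.ν Θ.τ9 P (gOfRecord₁₃ F 2 (Θ.liveRepin₁₃ F 2) P) (lam.kSel P + 1)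
        (slotsTOfRecord F 2 Θ.ν Θ.τ9 (EOfRecord₁₃ F 2 (Θ.liveRepin₁₃ F 2)) (wOfRecord₉ F 2 (Θ.liveRepin₁₃ F 2).toStage9Params)
          (Θ.liveRepin₁₃ F 2).ppSel P (gOfRecord₁₃ F 2 (Θ.liveRepin₁₃ F 2) P) (lam.kSel P + 1)) s →
      0 < ∫ V, rterm (reprTOfRecord₁₃ F 2 (Θ.liveRepin₁₃ F 2) P (lam.kSel P)) s V ∂(fieldMeasure (F.P P.K) (lam.kSel P + 1) (SU 2)))
    (h180 : ∀ P : B12.RunParams, lam.kSel P < P.K → ∀ U, new189 (lam.D189 P) U → ∀ i, (lam.D189 P).h ≤ i → i ≤ (lam.D189 P).k →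
      ∀ q ∈ plaqsOf (dom (lam.D189 P) i),
        Ineq180 ((lam.D189 P).dev0 U q) ((lam.D189 P).ε (lam.D189 P).k) (lam.D189 P).η (lam.D189 P).B₃ (lam.D189 P).B₅ (lam.D189 P).M (lam.D189 P).δ
          ((lam.D189 P).dist q) (lam.D189 P).O1)
    (h189 : ∀ P : B12.RunParams, lam.kSel P < P.K → Claim189 (new189 (lam.D189 P)) (chiPP (lam.D189 P)))
    -- dag-n12-w5's endpoint `N12Prop1DirectOfClassOnlyRowL1WindowUniform` ON THE RUN's LATTICE, per run `P` and instance family `ι P` (every letter of the endpoint displayed per run;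
    -- `hfar` from the knit's box letter `hZ1` by `far_letter_of_box`, the [15] torus-class letter from `h15` by `thm1TorusClass_of_variationalThm1RegSepCoP7M`)
    (hd3 : ∀ P : B12.RunParams, 3 ≤ (F.P P.K).d) (h0 : ∀ P : B12.RunParams, 0 < (F.P P.K).d) (ι : B12.RunParams → Type)
    {B₃ a₀ a₁' : ℝ}
    (Z Λ : ∀ P : B12.RunParams, ι P → Set (Site (F.P P.K) 0)) (k : ∀ P : B12.RunParams, ι P → ℕ) (M : ∀ P : B12.RunParams, ι P → ℝ) (hk0 : ∀ (P : B12.RunParams) (i : ι P), 0 < k P i) (hk1 : ∀ (P : B12.RunParams) (i : ι P), k P i + 1 ≤ (F.P P.K).m + (F.P P.K).K)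
    (eR : ∀ P : B12.RunParams, ι P → ℝ) (heR : ∀ (P : B12.RunParams) (i : ι P), 0 < eR P i)
    (T : ∀ (P : B12.RunParams) (i : ι P), Finset (PBond (F.P P.K) (k P i)))
    (lo hi : ∀ P : B12.RunParams, ι P → Fin (F.P P.K).d → ℤ) (n : ∀ P : B12.RunParams, ι P → ℕ) (hn : ∀ (P : B12.RunParams) (i : ι P) κ, hi P i κ ≤ lo P i κ + n P i) (hN : ∀ (P : B12.RunParams) (i : ι P), n P i + 2 < (F.P P.K).sitesPerDir (k P i))
    (hbox : ∀ (P : B12.RunParams) (i : ι P), pts (k P i) (Λ P i) = (castSite '' Set.Icc (lo P i) (hi P i) : Set (Site (F.P P.K) (k P i))))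
    (hZ : ∀ (P : B12.RunParams) (i : ι P), (boxPlaqs (lo P i - 1) (hi P i + 1) : Set (Plaq (F.P P.K) (k P i))) ⊆ plaqsInside (pts (k P i) (Z P i)))
    (hTG0 : ∀ (P : B12.RunParams) (i : ι P), T P i = (box (fun κ => (hi P i κ - lo P i κ + 1).toNat) (lo P i)).image fun x =>
      (⟨castSite (x - unitVec ⟨0, h0 P⟩), ⟨0, h0 P⟩⟩ : PBond (F.P P.K) (k P i)))
    (hN5 : ∀ (P : B12.RunParams) (i : ι P) κ, ((hi P i κ - lo P i κ + 1).toNat : ℤ) + 5 < (F.P P.K).sitesPerDir (k P i))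
    (Kb : ∀ P : B12.RunParams, ι P → ℕ) (hK1 : ∀ (P : B12.RunParams) (i : ι P), 1 ≤ Kb P i) (hKn : ∀ (P : B12.RunParams) (i : ι P) κ, (hi P i κ - lo P i κ + 1).toNat ≤ Kb P i)
    (ext : ∀ (P : B12.RunParams) (i : ι P), GaugeField (F.P P.K) (k P i) SU2 → GaugeField (F.P P.K) (k P i) SU2)
    (hext : ∀ (P : B12.RunParams) (i : ι P) Vk, ext P i Vk = extend (pts (k P i) (Λ P i)) (shellGauge Vk (lo P i) (hi P i)) Vk)
    (hlohi : ∀ (P : B12.RunParams) (i : ι P), lo P i ≤ hi P i)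
    -- the REGION parallelepipeds of the normalisation and the datum tolerances
    (LO HI : ∀ P : B12.RunParams, ι P → Fin (F.P P.K).d → ℤ) (hLO : ∀ (P : B12.RunParams) (i : ι P), LO P i ≤ lo P i - 1) (hHI : ∀ (P : B12.RunParams) (i : ι P), hi P i + 1 ≤ HI P i) (n' : ∀ P : B12.RunParams, ι P → ℕ) (hn' : ∀ (P : B12.RunParams) (i : ι P) κ, HI P i κ ≤ LO P i κ + n' P i)
    (hn'N : ∀ (P : B12.RunParams) (i : ι P), n' P i < (F.P P.K).sitesPerDir (k P i)) (hR' : ∀ (P : B12.RunParams) (i : ι P), (boxPlaqs (LO P i) (HI P i) : Set (Plaq (F.P P.K) (k P i))) ⊆ plaqsInside (pts (k P i) (Z P i)))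
    (ρn : ∀ P : B12.RunParams, ι P → ℝ)
    (hρn : ∀ (P : B12.RunParams) (i : ι P), (((F.P P.K).d : ℝ) * n' P i + 1) * ((((F.P P.K).d - 1 : ℕ) : ℝ) * n' P i * ((12 * (F.P P.K).d * (n P i + 2) ^ 2 + 1) * eR P i)
      + 3 * (F.P P.K).d * (n P i + 2) ^ 2 * eR P i) ≤ ρn P i)
    {γ₈ cJ bx : B12.RunParams → ℝ} (hγ : ∀ P : B12.RunParams, 0 < γ₈ P) (hcJ : ∀ P : B12.RunParams, 0 ≤ cJ P) (hbx : ∀ P : B12.RunParams, 0 ≤ bx P)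
    (hbxM : ∀ (P : B12.RunParams) (i : ι P), 12 * ((F.P P.K).d : ℝ) * ((n P i : ℝ) + 2) ^ 2 ≤ bx P * (M P i) ^ 2)
    {R 𝓐₀ : ∀ P : B12.RunParams, ι P → ℝ} (hM : ∀ (P : B12.RunParams) (i : ι P), 1 ≤ (M P i)) (hR : ∀ (P : B12.RunParams) (i : ι P), 0 < R P i) (h𝓐₀ : ∀ (P : B12.RunParams) (i : ι P), 0 ≤ 𝓐₀ P i)
    -- (J0′), R-EXPLICIT: per instance one radius and one bound for every base field of the strict guard
    (hMin : ∀ (P : B12.RunParams) (i : ι P) Vk, PlaqSmallOn (plaqsInside (pts (k P i) (Z P i ∩ (Λ P i)ᶜ))) (eR P i) Vk →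
      ∃ Ũ : VecField (F.P P.K) (k P i) (EuclideanSpace ℂ (Fin 3)) × VecField (F.P P.K) (k P i) (EuclideanSpace ℂ (Fin 3)) →
          PBond (F.P P.K) 0 → Matrix (Fin 2) (Fin 2) ℂ,
        (∀ b a c, DifferentiableOn ℂ (fun z => Ũ z b a c) (ball 0 (R P i))) ∧
        (∀ z ∈ ball (0 : VecField (F.P P.K) (k P i) (EuclideanSpace ℂ (Fin 3)) × VecField (F.P P.K) (k P i) (EuclideanSpace ℂ (Fin 3))) (R P i),
          ∀ b a c, ‖Ũ z b a c‖ ≤ 𝓐₀ P i) ∧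
        ∀ p B' : VecField (F.P P.K) (k P i) E3, ‖p‖ < R P i → ‖B'‖ < R P i → ∃ U' : GaugeField (F.P P.K) 0 SU2,
          (∀ b, Ũ (cplxVec p, cplxVec B') b = ((U' b : SU2) : Matrix (Fin 2) (Fin 2) ℂ)) ∧
            IsMinimizer (Node00.avOfRecord F 2 P.K) (Node00.regMSCoPOfRecord F 2 Θ.ν P.K (k P i) (maxDomT Θ.ν.M₁ (Z P i))) (Bj Θ.ν.M₁ (Z P i) (k P i))
              (avgFamily (Node00.avOfRecord F 2 P.K) (qsstarGIter0 (k P i) (expMul su2Chart B' (ext P i (expMul su2Chart p Vk))))) U')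
    -- dag-n12-w4's GEOMETRY letter of the chart file (the window box and its two shifts inside `Ω_k(Z)`)
    (hΩw : ∀ (P : B12.RunParams) (i : ι P), ∀ (ν' : Fin (F.P P.K).d), ∀ z ∈ box (fun κ => (hi P i κ - lo P i κ + 1).toNat + 3) (fun κ => lo P i κ - 2),
      (castSite z : Site (F.P P.K) (k P i)) ∈ pts (k P i) (maxDomT Θ.ν.M₁ (Z P i) (k P i)) ∧
        (castSite z : Site (F.P P.K) (k P i)).shift ⟨0, h0 P⟩ ∈ pts (k P i) (maxDomT Θ.ν.M₁ (Z P i) (k P i)) ∧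
        (castSite z : Site (F.P P.K) (k P i)).shift ν' ∈ pts (k P i) (maxDomT Θ.ν.M₁ (Z P i) (k P i)))
    -- the WINDOW per instance, containing every plaquette whose source lies in the fine image of the enlarged window box (the chart half's `hW`)
    (W : ∀ P : B12.RunParams, ι P → Finset (Plaq (F.P P.K) 0))
    (hWbox : ∀ (P : B12.RunParams) (i : ι P), ∀ q : Plaq (F.P P.K) 0, q.src ∈ ((box (fun κ => (F.P P.K).L ^ (k P i) * ((hi P i κ - lo P i κ + 1).toNat + 3 + 1) - 1) (fun κ => ((F.P P.K).L : ℤ) ^ (k P i) * (lo P i κ - 2))).image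
        (fun z => (castSite z : Site (F.P P.K) 0))) → q ∈ W P i)
    -- dag-n12-w6 g7's k-UNIFORM WINDOW-LOCAL (σ)_W producer `N12WindowGaugeLetterUniformSocket.hσW_on_uniform_of_class` (general `Z`, no letter off the window, tolerance `C(d,L)·εreg + m′·ρn`
    -- INDEPENDENT of `k`): its NUMERICS per instance (level guard `k + c ≤ m + K` with `4d + m′ + 3 < 2L^c`), the class threshold `εreg` positive and Prop. 2-small, the WINDOW `X i` within
    -- walk-distance `D₀ i` of `Ω_{k_i}(Z_i)` (`hXΩ`) with the collar fit `hfit`, the REGION-BOX ROW `hBox` and the two window rows `hWX hfeedsX`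
    (c : ∀ P : B12.RunParams, ι P → ℕ) (hkc : ∀ (P : B12.RunParams) (i : ι P), k P i + c P i ≤ (F.P P.K).m + (F.P P.K).K) (hc : ∀ (P : B12.RunParams) (i : ι P), 4 * (F.P P.K).d + (3 * ((F.P P.K).d * (((F.P P.K).L - 1) / 2)) + 5) + 3 < 2 * (F.P P.K).L ^ c P i)
    (hα3 : ∀ P : B12.RunParams, (143 * (((((F.P P.K).d + 4 : ℕ) : ℝ)) ^ 2 / 4) ^ 2) * (Θ.ν.εreg * (F.P P.K).L ^ 2) ≤ 1 / 3)
    (hα2 : ∀ P : B12.RunParams, 2 * (Θ.ν.εreg * (F.P P.K).L ^ 2) ≤ 2 * deltaSU (Fin 2) / ((((F.P P.K).d + 4) * (F.P P.K).L : ℕ) : ℝ) ^ 2)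
    (haN : ∀ P : B12.RunParams, (((((F.P P.K).d + 2) * (F.P P.K).L : ℕ) : ℝ) ^ 2 / 4) * (2 * (Θ.ν.εreg * (F.P P.K).L ^ 2)) < deltaSU (Fin 2))
    (X : ∀ P : B12.RunParams, ι P → Set (Site (F.P P.K) 0)) (D₀ : ∀ P : B12.RunParams, ι P → ℕ)
    (hXΩ : ∀ (P : B12.RunParams) (i : ι P), ∀ x ∈ X P i, ∃ x₀ ∈ maxDomT Θ.ν.M₁ (Z P i) (k P i), ∃ w₀ : List (Letter (F.P P.K).d), w₀.length ≤ D₀ P i ∧ walkEnd x₀ w₀ = x)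
    (hfit : ∀ (P : B12.RunParams) (i : ι P), D₀ P i + 3 * (∑ i' ∈ Finset.range (k P i + 1), ((F.P P.K).d * (((F.P P.K).L ^ i' - 1) / 2) + 1)) + ((3 * ((F.P P.K).d * (((F.P P.K).L - 1) / 2)) + 5) + 5) * (F.P P.K).L ^ k P i +
      (((F.P P.K).d + 4) * (F.P P.K).L + 2) * (∑ l ∈ Finset.Ico 0 (k P i), (F.P P.K).L ^ l) + 4 ≤ (F.P P.K).L ^ (k P i - 1) * Θ.ν.M₁)
    (hBox : ∀ (P : B12.RunParams) (i : ι P), ∀ x ∈ X P i, ∀ w : List (Letter (F.P P.K).d),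
      w.length ≤ (∑ i' ∈ Finset.range (k P i + 1), ((F.P P.K).d * (((F.P P.K).L ^ i' - 1) / 2) + 1)) + (3 * ((F.P P.K).d * (((F.P P.K).L - 1) / 2)) + 5) * (F.P P.K).L ^ k P i + (F.P P.K).L ^ k P i →
      ∀ μ : Fin (F.P P.K).d, (⟨B14.Eq22Determines.blockIter (k P i) (walkEnd x w), μ⟩ : PBond (F.P P.K) (k P i)) ∈ (boxBonds (LO P i) (HI P i) : Set (PBond (F.P P.K) (k P i))))
    (hWX : ∀ (P : B12.RunParams) (i : ι P), ∀ p ∈ W P i, p.src ∈ X P i ∧ p.src.shift p.μ ∈ X P i ∧ p.src.shift p.ν ∈ X P i ∧ (p.src.shift p.μ).shift p.ν ∈ X P i ∧ (p.src.shift p.ν).shift p.μ ∈ X P i)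
    (hfeedsX : ∀ (P : B12.RunParams) (i : ι P) (ν' : Fin (F.P P.K).d), ∀ z ∈ box (fun κ => (hi P i κ - lo P i κ + 1).toNat + 3) (fun κ => lo P i κ - 2), ∀ b₀ : PBond (F.P P.K) 0,
      (b₀ ∈ feeds (k P i) (⟨(castSite z : Site (F.P P.K) (k P i)), ⟨0, h0 P⟩⟩ : PBond (F.P P.K) (k P i)) ∨
        b₀ ∈ feeds (k P i) (⟨((castSite z : Site (F.P P.K) (k P i))).shift ⟨0, h0 P⟩, ν'⟩ : PBond (F.P P.K) (k P i)) ∨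
        b₀ ∈ feeds (k P i) (⟨((castSite z : Site (F.P P.K) (k P i))).shift ν', ⟨0, h0 P⟩⟩ : PBond (F.P P.K) (k P i)) ∨
        b₀ ∈ feeds (k P i) (⟨(castSite z : Site (F.P P.K) (k P i)), ν'⟩ : PBond (F.P P.K) (k P i))) → b₀.src ∈ X P i ∧ b₀.tgt ∈ X P i)
    -- THE CHART HALF, DISPLAYED, `hsb`-FREE AND IN PER-ROW ℓ¹ CURRENCY (LOCATED-FLOOR + LOCATED-HSB + census U2b): FIVE per-height constants as BINDERS and ONE letter = the ∀-body of
    -- dag-n12-c g22's ρ6b `N12DirectChartPackageOfClassRowL1Family.exists_hWD_chartHalf_of_class_uniform_rowl1_family` at height `k i` (the right inverse `H` witnesses surjectivity only;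
    -- its size enters through the PER-ROW ℓ¹ PREIMAGE LETTER at `B₁`, the curvature through the ℓ¹-curvature letter at `M₂`; (μ) constant `2(d−1)·εP·B₁·M₂` — NO torus bond count)
    (C ρ Kτ ρτ ρ5 : ∀ P : B12.RunParams, ι P → ℝ) (hρ : ∀ (P : B12.RunParams) (i : ι P), 0 < ρ P i) (hKτ : ∀ (P : B12.RunParams) (i : ι P), 0 ≤ Kτ P i) (hρτ : ∀ (P : B12.RunParams) (i : ι P), 0 < ρτ P i)
    (hhalf : ∀ (P : B12.RunParams) (i : ι P),
        ∀ (νu : Node00.Stage7Numerics) (Z Λ : Set (Site (F.P P.K) 0)) (T : Finset (PBond (F.P P.K) (k P i))) (lo hi : Fin (F.P P.K).d → ℤ),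
        (∀ κ, ((((hi κ - lo κ + 1).toNat + 3 : ℕ) : ℤ)) ≤ (F.P P.K).sitesPerDir (k P i)) →
        (∀ (ν' : Fin (F.P P.K).d), ∀ z ∈ box (fun κ => (hi κ - lo κ + 1).toNat + 3) (fun κ => lo κ - 2),
          (castSite z : Site (F.P P.K) (k P i)) ∈ pts (k P i) (maxDomT νu.M₁ Z (k P i)) ∧ (castSite z : Site (F.P P.K) (k P i)).shift ⟨0, h0 P⟩ ∈ pts (k P i) (maxDomT νu.M₁ Z (k P i)) ∧
            (castSite z : Site (F.P P.K) (k P i)).shift ν' ∈ pts (k P i) (maxDomT νu.M₁ Z (k P i))) →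
        (k P i) + 1 ≤ (F.P P.K).m + (F.P P.K).K → 4 * (F.P P.K).L ≤ νu.M₁ → side (F.P P.K).L νu.M₁ (k P i) ∣ (F.P P.K).sitesPerDir 0 → 0 ≤ νu.εreg →
        6 * ((((F.P P.K).d - 1 : ℕ)) : ℝ) * (F.P P.K).L * νu.εreg ≤ ρ5 P i →
        ∀ (ext : GaugeField (F.P P.K) (k P i) SU2 → GaugeField (F.P P.K) (k P i) SU2) (Vk : GaugeField (F.P P.K) (k P i) SU2),
        ∀ (U₀ : GaugeField (F.P P.K) 0 SU2) (Xf : GaugeSlice (pts (k P i) Λ) T E3 → PBond (F.P P.K) 0 → lieSU (Fin 2)),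
        IsMinimizer (Node00.avOfRecord F 2 P.K) (Node00.regMSCoPOfRecord F 2 νu P.K (k P i) (maxDomT νu.M₁ Z)) (Bj νu.M₁ Z (k P i))
          (avgFamily (Node00.avOfRecord F 2 P.K) (qsstarGIter0 (k P i) (ext Vk))) U₀ →
        ∀ ⦃εP : ℝ⦄, 0 ≤ εP →
        (∀ p : Plaq (F.P P.K) 0, ((⟨p.src, p.μ⟩ : PBond (F.P P.K) 0) ∈ {b : PBond (F.P P.K) 0 | b.src ∈ maxDomT νu.M₁ Z 1} ∨
            (⟨p.src.shift p.μ, p.ν⟩ : PBond (F.P P.K) 0) ∈ {b : PBond (F.P P.K) 0 | b.src ∈ maxDomT νu.M₁ Z 1} ∨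
            (⟨p.src.shift p.ν, p.μ⟩ : PBond (F.P P.K) 0) ∈ {b : PBond (F.P P.K) 0 | b.src ∈ maxDomT νu.M₁ Z 1} ∨
            (⟨p.src, p.ν⟩ : PBond (F.P P.K) 0) ∈ {b : PBond (F.P P.K) 0 | b.src ∈ maxDomT νu.M₁ Z 1}) →
          ‖((GaugeField.plaqHol U₀ p : SU2) : Matrix (Fin 2) (Fin 2) ℂ) - 1‖ ≤ εP) →
        ∀ (H : (Fin (constrCard (Bj νu.M₁ Z (k P i)) (k P i)) → lieSU (Fin 2)) → PBond (F.P P.K) 0 → lieSU (Fin 2)),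
        (∀ v, fderiv ℝ (msChart F 2 P.K (k P i) (Bj νu.M₁ Z (k P i)) (avgFamily (avOfRecord F 2 P.K) (qsstarGIter0 (k P i) (ext Vk))) U₀) 0 (H v) = v) →
        ∀ ⦃B₁ : ℝ⦄, 0 ≤ B₁ →
        (∀ i' : Fin (constrCard (Bj νu.M₁ Z (k P i)) (k P i)), 1 ≤ ((((constrEnum (Bj νu.M₁ Z (k P i)) (k P i)).symm i').1 : ℕ)) → ∀ ξ : lieSU (Fin 2),
          ∃ x : PBond (F.P P.K) 0 → lieSU (Fin 2), fderiv ℝ (msChart F 2 P.K (k P i) (Bj νu.M₁ Z (k P i)) (avgFamily (avOfRecord F 2 P.K) (qsstarGIter0 (k P i) (ext Vk))) U₀) 0 x = Pi.single i' ξ ∧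
            ∑ b, ‖(x b : Matrix (Fin 2) (Fin 2) ℂ)‖ ≤ B₁ * ‖ξ‖) →
        ∀ ⦃M₂ : ℝ⦄, (∀ w, ∑ c, ‖fderiv ℝ (fderiv ℝ (msChart F 2 P.K (k P i) (Bj νu.M₁ Z (k P i)) (avgFamily (avOfRecord F 2 P.K) (qsstarGIter0 (k P i) (ext Vk))) U₀)) 0 w w c‖ ≤ M₂ * ∑ b, ‖w b‖ ^ 2) →
        Xf 0 = 0 → ContDiffAt ℝ 2 Xf 0 →
        (∀ᶠ Y in 𝓝 (0 : GaugeSlice (pts (k P i) Λ) T E3),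
          IsMinimizer (Node00.avOfRecord F 2 P.K) (Node00.regMSCoPOfRecord F 2 νu P.K (k P i) (maxDomT νu.M₁ Z)) (Bj νu.M₁ Z (k P i))
            (avgFamily (Node00.avOfRecord F 2 P.K) (qsstarGIter0 (k P i) (expMul su2Chart (ιA (pts (k P i) Λ) T Y) (ext Vk)))) (expChart U₀ (Xf Y))) →
        ∀ ⦃K₂ : ℝ⦄, (∀ X : GaugeSlice (pts (k P i) Λ) T E3, Real.sqrt (∑ b, ‖fderiv ℝ Xf 0 X b‖ ^ 2) ≤ K₂ * ‖X‖) →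
        ∀ (W : Finset (Plaq (F.P P.K) 0)),
        (∀ q : Plaq (F.P P.K) 0, q.src ∈ ((box (fun κ => (F.P P.K).L ^ (k P i) * ((hi κ - lo κ + 1).toNat + 3 + 1) - 1) (fun κ => ((F.P P.K).L : ℤ) ^ (k P i) * (lo κ - 2))).image
            (fun z => (castSite z : Site (F.P P.K) 0))) → q ∈ W) →
        ∀ ⦃δW : ℝ⦄, 0 < δW → δW < ρ P i → δW < ρτ P i →
        (∀ (ν' : Fin (F.P P.K).d), ∀ z ∈ box (fun κ => (hi κ - lo κ + 1).toNat + 3) (fun κ => lo κ - 2), ∀ b₀ : PBond (F.P P.K) 0,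
          (b₀ ∈ feeds (k P i) (⟨(castSite z : Site (F.P P.K) (k P i)), ⟨0, h0 P⟩⟩ : PBond (F.P P.K) (k P i)) ∨ b₀ ∈ feeds (k P i) (⟨((castSite z : Site (F.P P.K) (k P i))).shift ⟨0, h0 P⟩, ν'⟩ : PBond (F.P P.K) (k P i))
          ∨ b₀ ∈ feeds (k P i) (⟨((castSite z : Site (F.P P.K) (k P i))).shift ν', ⟨0, h0 P⟩⟩ : PBond (F.P P.K) (k P i)) ∨ b₀ ∈ feeds (k P i) (⟨(castSite z : Site (F.P P.K) (k P i)), ν'⟩ : PBond (F.P P.K) (k P i))) →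
          ‖((U₀ b₀ : SU2) : Matrix (Fin 2) (Fin 2) ℂ) - 1‖ ≤ δW) →
        ∃ (Ψ₂ : (PBond (F.P P.K) 0 → lieSU (Fin 2)) →L[ℝ] (PBond (F.P P.K) 0 → lieSU (Fin 2)) →L[ℝ] (Fin (constrCard (Bj νu.M₁ Z (k P i)) (k P i)) → lieSU (Fin 2)))
          (lam : (Fin (constrCard (Bj νu.M₁ Z (k P i)) (k P i)) → lieSU (Fin 2)) →L[ℝ] ℝ)
          (p : Seminorm ℝ (PBond (F.P P.K) 0 → lieSU (Fin 2))),
          HasFDerivAt (fun Y => fderiv ℝ (msChart F 2 P.K (k P i) (Bj νu.M₁ Z (k P i)) (avgFamily (avOfRecord F 2 P.K) (qsstarGIter0 (k P i) (ext Vk))) U₀) Y) Ψ₂ 0 ∧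
          (∀ᶠ Y in 𝓝 (0 : PBond (F.P P.K) 0 → lieSU (Fin 2)), DifferentiableAt ℝ (msChart F 2 P.K (k P i) (Bj νu.M₁ Z (k P i)) (avgFamily (avOfRecord F 2 P.K) (qsstarGIter0 (k P i) (ext Vk))) U₀) Y) ∧
          fderiv ℝ (fun Y : PBond (F.P P.K) 0 → lieSU (Fin 2) => wilsonAction4 (expChart U₀ Y)) 0 = lam.comp (fderiv ℝ (msChart F 2 P.K (k P i) (Bj νu.M₁ Z (k P i)) (avgFamily (avOfRecord F 2 P.K) (qsstarGIter0 (k P i) (ext Vk))) U₀) 0) ∧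
          (∀ Y : PBond (F.P P.K) 0 → lieSU (Fin 2), ∑ b, ‖(Y b : Matrix (Fin 2) (Fin 2) ℂ)‖ ^ 2 ≤ p Y ^ 2) ∧
          ∀ X : GaugeSlice (pts (k P i) Λ) T E3,
            lam (Ψ₂ (fderiv ℝ Xf 0 X) (fderiv ℝ Xf 0 X))
                ≤ (2 * (((F.P P.K).d : ℝ) - 1) * εP * B₁ * M₂) * p (fderiv ℝ Xf 0 X) ^ 2 ∧
            p (fderiv ℝ Xf 0 X) ≤ K₂ * ‖X‖ ∧
            (((F.P P.K).L : ℝ) ^ (F.P P.K).d) ^ (k P i) / ((((F.P P.K).L : ℝ)) ^ 2 * ((F.P P.K).L : ℝ) ^ 2) ^ (k P i) / 2 * (∑ z ∈ box (fun κ => (hi κ - lo κ + 1).toNat + 3) (fun κ => lo κ - 2), ∑ μ : Fin (F.P P.K).d, ∑ a : Fin 3, curl (fun b => ιA (pts (k P i) Λ) T X (⟨castSite b.1, b.2⟩ : PBond (F.P P.K) (k P i)) a) z ⟨0, h0 P⟩ μ ^ 2)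
                - (((F.P P.K).L : ℝ) ^ (F.P P.K).d) ^ (k P i) / ((((F.P P.K).L : ℝ)) ^ 2 * ((F.P P.K).L : ℝ) ^ 2) ^ (k P i) * (8 * (((F.P P.K).d : ℝ) + 1) * (2 * ((Kτ P i) + 1) * δW) + 8 * ((F.P P.K).d : ℝ) * (((box (fun κ => (hi κ - lo κ + 1).toNat + 3) (fun κ => lo κ - 2)).image (fun z => (castSite z : Site (F.P P.K) (k P i)))).card : ℝ) * ((C P i) * δW * K₂) ^ 2) * ‖X‖ ^ 2
              ≤ ((Fintype.card (Fin 2) : ℝ)⁻¹ • ∑ p ∈ W, (innerSL ℝ (E := lieSU (Fin 2))).bilinearComp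
                (ContinuousLinearMap.proj (R := ℝ) (φ := fun _ : PBond (F.P P.K) 0 => lieSU (Fin 2)) (⟨p.src, p.μ⟩ : PBond (F.P P.K) 0) + ContinuousLinearMap.proj (R := ℝ) (φ := fun _ : PBond (F.P P.K) 0 => lieSU (Fin 2)) (⟨p.src.shift p.μ, p.ν⟩ : PBond (F.P P.K) 0)
                  - ContinuousLinearMap.proj (R := ℝ) (φ := fun _ : PBond (F.P P.K) 0 => lieSU (Fin 2)) (⟨p.src.shift p.ν, p.μ⟩ : PBond (F.P P.K) 0) - ContinuousLinearMap.proj (R := ℝ) (φ := fun _ : PBond (F.P P.K) 0 => lieSU (Fin 2)) (⟨p.src, p.ν⟩ : PBond (F.P P.K) 0) : (PBond (F.P P.K) 0 → lieSU (Fin 2)) →L[ℝ] lieSU (Fin 2))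
                (ContinuousLinearMap.proj (R := ℝ) (φ := fun _ : PBond (F.P P.K) 0 => lieSU (Fin 2)) (⟨p.src, p.μ⟩ : PBond (F.P P.K) 0) + ContinuousLinearMap.proj (R := ℝ) (φ := fun _ : PBond (F.P P.K) 0 => lieSU (Fin 2)) (⟨p.src.shift p.μ, p.ν⟩ : PBond (F.P P.K) 0)
                  - ContinuousLinearMap.proj (R := ℝ) (φ := fun _ : PBond (F.P P.K) 0 => lieSU (Fin 2)) (⟨p.src.shift p.ν, p.μ⟩ : PBond (F.P P.K) 0) - ContinuousLinearMap.proj (R := ℝ) (φ := fun _ : PBond (F.P P.K) 0 => lieSU (Fin 2)) (⟨p.src, p.ν⟩ : PBond (F.P P.K) 0) : (PBond (F.P P.K) 0 → lieSU (Fin 2)) →L[ℝ] lieSU (Fin 2))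
                : (PBond (F.P P.K) 0 → lieSU (Fin 2)) →L[ℝ] (PBond (F.P P.K) 0 → lieSU (Fin 2)) →L[ℝ] ℝ) (fderiv ℝ Xf 0 X) (fderiv ℝ Xf 0 X))
    -- the `hsb`-free letter's numeric premises displayed: radius row, the class threshold positive, and its floor against the per-height curvature radius `ρ5`
    (hM4 : ∀ P : B12.RunParams, 4 * (F.P P.K).L ≤ Θ.ν.M₁) (hερ : ∀ (P : B12.RunParams) (i : ι P), 6 * ((((F.P P.K).d - 1 : ℕ)) : ℝ) * (F.P P.K).L * Θ.ν.εreg ≤ ρ5 P i)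
    -- THE (P4)′ PRODUCER's TWO CONSTANTS, THE (P5) CONSTANT AND THE NEAR-FLAT GUARD RADIUS PER INSTANCE, AS BINDERS (`εH`, `ρ6`, `M₂` per height; `B₁` per `(M₁, Z)` — never after `εreg`∕`ρn`),
    -- and THREE LETTERS displayed: `hHrow` = dag-n12-w6 g7's `N12DirectSurjHsurjProxies.exists_rightInverse_letter_of_proxies` (p678596) premises at `(2, Kt, k i, ν.M₁, Z i; εH i)` VERBATIM —
    -- NO `SmallBelow U₀`: its guarded PROXIES (per constrained bond, per inner site) are produced from the class below — concluding, in ρ6b's PER-ROW ℓ¹ CURRENCY, a right inverse `H`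
    -- (surjectivity witness) AND the per-row ℓ¹ preimage letter at `B₁ i`; `hsbU` ∕ `hcurv` = the two conjuncts of dag-n12-w4's `Node00.exists_uniform_chartCurvature_sq_bound (k i)` at
    -- `(ρ6 i, M₂ i)` (near-flat fields are guarded; uniform sup-curvature bound at the near-flat core) — ρ7 turns them into the ℓ¹-curvature bound with the local count `Σ_{j≤k i}(2d)^j`
    (εH B₁ M₂ ρ6 : ∀ P : B12.RunParams, ι P → ℝ) (hB1 : ∀ (P : B12.RunParams) (i : ι P), 0 ≤ B₁ P i) (hM₂0 : ∀ (P : B12.RunParams) (i : ι P), 0 ≤ M₂ P i)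
    (hHrow : ∀ (P : B12.RunParams) (i : ι P) (Wd : MSField (F.P P.K) SU2) (U₀ : GaugeField (F.P P.K) 0 SU2),
      AgreeOn (Bj Θ.ν.M₁ (Z P i) (k P i)) (avgFamily (Node00.avOfRecord F 2 P.K) U₀) Wd →
      (∀ i' : Fin (constrCard (Bj Θ.ν.M₁ (Z P i) (k P i)) (k P i)), ∃ U' : GaugeField (F.P P.K) 0 SU2,
        (∀ b ∈ feeds (((constrEnum (Bj Θ.ν.M₁ (Z P i) (k P i)) (k P i)).symm i').1 : ℕ) ((constrEnum (Bj Θ.ν.M₁ (Z P i) (k P i)) (k P i)).symm i').2.1, U' b = U₀ b) ∧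
          Node00.SmallBelow (Node00.avOfRecord F 2 P.K) (k P i) U') →
      (∀ (j : ℕ), 1 ≤ j → j ≤ k P i → ∀ y : Site (F.P P.K) j, embIter j y ∈ maxDomT Θ.ν.M₁ (Z P i) j → ∃ U' : GaugeField (F.P P.K) 0 SU2,
        (∀ c : PBond (F.P P.K) j, (c.src = y ∨ c.tgt = y) → ∀ b₀ : PBond (F.P P.K) 0,
          (iterBlockOf j b₀.src = c.src ∨ iterBlockOf j b₀.src = c.tgt) → (iterBlockOf j b₀.tgt = c.src ∨ iterBlockOf j b₀.tgt = c.tgt) → U' b₀ = U₀ b₀) ∧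
        Node00.SmallBelow (Node00.avOfRecord F 2 P.K) (k P i) U') →
      (∀ (j : ℕ), 1 ≤ j → j ≤ k P i → ∀ y : Site (F.P P.K) j, embIter j y ∈ maxDomT Θ.ν.M₁ (Z P i) j →
        PlaqSmallOn (boxPlaqs (fun κ => lift (F.P P.K) (embIter j y) κ - ((((F.P P.K).L ^ j : ℕ) : ℤ) + ((((F.P P.K).L ^ j - 1) / 2 : ℕ) : ℤ)))
          (fun κ => lift (F.P P.K) (embIter j y) κ + ((((F.P P.K).L ^ j : ℕ) : ℤ) + ((((F.P P.K).L ^ j - 1) / 2 : ℕ) : ℤ))) : Set (Plaq (F.P P.K) 0)) (εH P i) U₀) →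
      ∃ H : (Fin (constrCard (Bj Θ.ν.M₁ (Z P i) (k P i)) (k P i)) → lieSU (Fin 2)) → PBond (F.P P.K) 0 → lieSU (Fin 2),
        (∀ v, fderiv ℝ (msChart F 2 P.K (k P i) (Bj Θ.ν.M₁ (Z P i) (k P i)) Wd U₀) 0 (H v) = v) ∧
        ∀ i' : Fin (constrCard (Bj Θ.ν.M₁ (Z P i) (k P i)) (k P i)), 1 ≤ ((((constrEnum (Bj Θ.ν.M₁ (Z P i) (k P i)) (k P i)).symm i').1 : ℕ)) → ∀ ξ : lieSU (Fin 2),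
          ∃ x : PBond (F.P P.K) 0 → lieSU (Fin 2), fderiv ℝ (msChart F 2 P.K (k P i) (Bj Θ.ν.M₁ (Z P i) (k P i)) Wd U₀) 0 x = Pi.single i' ξ ∧
            ∑ b, ‖(x b : Matrix (Fin 2) (Fin 2) ℂ)‖ ≤ B₁ P i * ‖ξ‖)
    (hsbU : ∀ (P : B12.RunParams) (i : ι P) (V : GaugeField (F.P P.K) 0 SU2), ‖coeField V - 1‖ ≤ ρ6 P i → Node00.SmallBelow (Node00.avOfRecord F 2 P.K) (k P i) V)
    (hcurv : ∀ (P : B12.RunParams) (i : ι P) (𝔹 : DetSet (F.P P.K)) (Wd : MSField (F.P P.K) SU2) (V : GaugeField (F.P P.K) 0 SU2),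
      ‖coeField V - 1‖ ≤ ρ6 P i → AgreeOn 𝔹 (avgFamily (Node00.avOfRecord F 2 P.K) V) Wd →
      ∀ w : PBond (F.P P.K) 0 → lieSU (Fin 2), ‖fderiv ℝ (fderiv ℝ (msChart F 2 P.K (k P i) 𝔹 Wd V)) 0 w w‖ ≤ M₂ P i * ‖w‖ ^ 2)
    -- the near-flat radius's floor on the class threshold (volume-free)
    (hερ6 : ∀ (P : B12.RunParams) (i : ι P), 6 * ((((F.P P.K).d - 1 : ℕ)) : ℝ) * (F.P P.K).L * Θ.ν.εreg ≤ ρ6 P i)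
    -- NO letter per guarded base field ∕ minimiser remains here: the (P4)′ socket and the (P5) row are DISCHARGED below from the class through `hHrow` ∕ `hsbU` ∕ `hcurv` (+ ρ7's local count)
    -- numerics: the positivity constant fits (`γ₀ := 1∕2`: the chart half's level factor `((L^d)^k∕(L²·L²)^k)∕2` at `d = 4`)
    (hγle : ∀ (P : B12.RunParams) (i : ι P), γ₈ P / (M P i) ^ 5 ≤ 1 / 2 / (2 * (3 * (Kb P i : ℝ) ^ 2 + 2 * (Kb P i : ℝ) ^ 4)))
    -- the geometric letter: every fine site whose k-block label lies in the box `[lo − 1, hi + 1]` lies in `Ω₁(Z)` (print: `Λ` deep inside `Z`); dag-n12-c's `far_letter_of_box` turns it into the bond letter `hfar`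
    (hZ1 : ∀ (P : B12.RunParams) (i : ι P) (y : Site (F.P P.K) 0), B14.Eq22Determines.blockIter (k P i) y ∈ (castSite '' Set.Icc (lo P i - 1) (hi P i + 1) : Set (Site (F.P P.K) (k P i))) → y ∈ maxDomT Θ.ν.M₁ (Z P i) 1)
    (hZblk : ∀ (P : B12.RunParams) (i : ι P), IsBlockUnion (k P i) (Z P i))
    (hdiv : ∀ (P : B12.RunParams) (i : ι P), side (F.P P.K).L Θ.ν.M₁ (k P i) ∣ (F.P P.K).sitesPerDir 0)
    {cE cA : B12.RunParams → ℝ} (hcE0 : ∀ P : B12.RunParams, 0 ≤ cE P) (hcE : ∀ (P : B12.RunParams) (i : ι P), 12 * ((F.P P.K).d : ℝ) * ((n P i : ℝ) + 2) ^ 2 ≤ cE P)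
    (heRa : ∀ (P : B12.RunParams) (i : ι P), (cE P + 1) * eR P i ≤ a₁' ∧ B₃ * ((cE P + 1) * eR P i) ≤ Θ.ν.εreg)
    (hcA : ∀ P : B12.RunParams, 1 / 2 * (B₃ * (cE P + 1) * (F.P P.K).eta 1 ^ 2) ^ 2 * (Fintype.card (Plaq (F.P P.K) 0) : ℝ) ≤ cA P)
    (hcJ' : ∀ (P : B12.RunParams) (i : ι P), 2 * cA P * eR P i / R P i + 4 * ((Fintype.card (Plaq (F.P P.K) 0) : ℝ) * (1 + 8 * 𝓐₀ P i ^ 4)) / (R P i * eR P i) ≤ cJ P)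
    -- THE EXPLICIT-THRESHOLD FRAME (no `∃ δ₀`): tolerances below `Θ i := min (min (ρ i) (ρτ i) ∕ 2) (min 1 (rhs_i ∕ (max S_i 0 + 1)))`, every symbol a binder or a cardinality
    (hM2 : 2 ≤ Θ.ν.M₁) (hB₃ : 0 ≤ B₃) (hεreg : 0 < Θ.ν.εreg) (ha₀ : Θ.ν.εreg ≤ a₀) (h15 : VariationalThm1RegSepCoP7M F 2 B₃ a₀ a₁') :
    ∀ δ : ∀ P : B12.RunParams, ι P → ℝ, (∀ P i, 0 < δ P i) →
      -- the endpoint's EXPLICIT THRESHOLD per run (every quantity a displayed binder or a count of the run's instance — no `∃ δ₀`), then its TOLERANCE rows at `δ P i`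
      (∀ (P : B12.RunParams) (i : ι P), δ P i ≤ min (min (min (ρ P i) (ρτ P i) / 2)
        (min 1 (1 / 2 / (2 * (3 * (Kb P i : ℝ) ^ 2 + 2 * (Kb P i : ℝ) ^ 4)) /
          (max ((32 * (((F.P P.K).d : ℝ) - 1) + 8 * (((F.P P.K).d : ℝ) - 1) + (2 * (((F.P P.K).d : ℝ) - 1) * B₁ P i * (((∑ j ∈ Finset.range (k P i + 1), (2 * (F.P P.K).d) ^ j : ℕ) : ℝ) * M₂ P i))) * (12 * 𝓐₀ P i / R P i * Real.sqrt (Nat.card {b : PBond (F.P P.K) 0 // b.src ∈ maxDomT Θ.ν.M₁ (Z P i) 1})) ^ 2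
            + (8 * (((F.P P.K).d : ℝ) + 1) * (2 * (Kτ P i + 1)) + 8 * ((F.P P.K).d : ℝ) * (((box (fun κ => (hi P i κ - lo P i κ + 1).toNat + 3) (fun κ => lo P i κ - 2)).image (fun z => (castSite z : Site (F.P P.K) (k P i)))).card : ℝ) * (C P i * (12 * 𝓐₀ P i / R P i * Real.sqrt (Nat.card {b : PBond (F.P P.K) 0 // b.src ∈ maxDomT Θ.ν.M₁ (Z P i) 1}))) ^ 2)) 0 + 1)))) (εH P i)) →
      ∀ (hfloor : ∀ (P : B12.RunParams) (i : ι P), ((((4 * (F.P P.K).d + (3 * ((F.P P.K).d * (((F.P P.K).L - 1) / 2)) + 5) + 3 : ℕ) : ℝ)) ^ 2 * ((F.P P.K).L : ℝ) ^ 2 / 4 + ((3 * ((F.P P.K).d * (((F.P P.K).L - 1) / 2)) + 5 : ℕ) : ℝ) * (24 * (((((F.P P.K).d + 2) * (F.P P.K).L : ℕ) : ℝ) ^ 2 / 4))) * Θ.ν.εreg + ((3 * ((F.P P.K).d * (((F.P P.K).L - 1) / 2)) + 5 : ℕ) : ℝ) * ρn P i ≤ δ P i),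
      ∃ areg : ∀ P : B12.RunParams, ι P → ℝ, (∀ P i, 0 < areg P i) ∧
        ∀ P : B12.RunParams, lam.kSel P < P.K →
          B15Leaf (WOfRecord₁₃ F 2 (Θ.liveRepin₁₃ F 2)
            { lam with LF := fun P => lfVarOn su2Chart fun i => InstOn.std (Node00.bgMSCoPOfRecord F 2 Θ.ν P.K (k P i) (maxDomT Θ.ν.M₁ (Z P i))) Θ.ν.M₁ (Z P i) (Λ P i) (k P i) (M P i) (areg P i) (anExt (pts (k P i) (Λ P i)) (T P i) (fun177std (Node00.bgMSCoPOfRecord F 2 Θ.ν P.K (k P i) (maxDomT Θ.ν.M₁ (Z P i))) Θ.ν.M₁ (Z P i) (k P i)) (ext P i) (min (1 / 2) (min (R P i / 8) (γ₈ P / (M P i) ^ 5 * (R P i / 2) ^ 2 / (48 * (4 * ((Fintype.card (Plaq (F.P P.K) 0) : ℝ) * (1 + 8 * 𝓐₀ P i ^ 4)) / R P i + 1)))))) } P) := by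
  intro δtol hδtol hδtol_le hfloor
  choose areg hapos hrow using fun P : B12.RunParams =>
    exists_domain_prop1Printed_lfVarOn_std_su2_box_intrinsic_analytic_atZSeqCoPRecord_ofThm1TorusClass_ofMinimiserFamily_ofClassOnlyRowL1_ofWindowGaugeUniform_explicit (F := F) Θ.ν P.K (hd3 P) (h0 P)
      (Z := Z P) (Λ := Λ P) (k := k P) (M := M P) (hk0 := hk0 P) (hk1 := hk1 P) (eR := eR P) (heR := heR P) (T := T P) (lo := lo P) (hi := hi P) (n := n P) (hn := hn P)
      (hN := hN P) (hbox := hbox P) (hZ := hZ P) (hTG0 := hTG0 P) (hN5 := hN5 P) (K := Kb P) (hK1 := hK1 P) (hKn := hKn P) (ext := ext P) (hext := hext P) (hlohi := hlohi P)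
      (LO := LO P) (HI := HI P) (hLO := hLO P) (hHI := hHI P) (n' := n' P) (hn' := hn' P) (hn'N := hn'N P) (hR' := hR' P) (ρn := ρn P) (hρn := hρn P) (hγ := hγ P)
      (hcJ := hcJ P) (hbx := hbx P) (hbxM := hbxM P) (hM := hM P) (hR := hR P) (h𝓐₀ := h𝓐₀ P) (hMin := hMin P) (hΩw := hΩw P) (W := W P) (hWbox := hWbox P) (c := c P)
      (hkc := hkc P) (hc := hc P) (hα3 := hα3 P) (hα2 := hα2 P) (haN := haN P) (X := X P) (D₀ := D₀ P) (hXΩ := hXΩ P) (hfit := hfit P) (hBox := hBox P) (hWX := hWX P)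
      (hfeedsX := hfeedsX P) (C := C P) (ρ := ρ P) (Kτ := Kτ P) (ρτ := ρτ P) (ρ5 := ρ5 P) (hρ := hρ P) (hKτ := hKτ P) (hρτ := hρτ P) (hhalf := hhalf P) (hM4 := hM4 P)
      (hεreg := hεreg) (hερ := hερ P) (εH := εH P) (B₁ := B₁ P) (M₂ := M₂ P) (ρ6 := ρ6 P) (hB1 := hB1 P) (hM₂0 := hM₂0 P) (hHrow := hHrow P) (hsbU := hsbU P)
      (hcurv := hcurv P) (hερ6 := hερ6 P) (hγle := hγle P) (hfar := fun i b hb => far_letter_of_box (hbox P i) (hZ1 P i) b hb) (hZblk := hZblk P) (hM2 := hM2)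
      (hdiv := hdiv P) (hcE0 := hcE0 P) (hcE := hcE P) (hB₃ := hB₃) (heRa := heRa P) (ha₀ := ha₀) (hcA := hcA P) (h15T := thm1TorusClass_of_variationalThm1RegSepCoP7M Θ.ν P.K h15)
      (hcJ' := hcJ' P)
      (δtol P) (hδtol P) (hδtol_le P) (hfloor P)
  refine ⟨areg, hapos, fun P hkP => ?_⟩
  apply b15Leaf_WOfRecord₁₃_liveRepin₁₃_of_massLive_of_hasResiduals Θ _ hres (P := P)
  · exact hkP
  · exact hpin P hkP
  · exact hmassLive P hkP
  · exact hrow P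
  · exact h180 P hkP
  · exact h189 P hkP

end Generic

end Summit.QuantumFields.YangMills.BalabanUVNodes.N12AtRecord13Prop1KnitThm1WindowDirectOfClassOnlyRowL1OfRecord

end
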